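import Literature.NumberTheory.GaloisRepresentations.GaloisRep
import HarnessLib

/-!
# Equivalent framed representations are conjugate

Topic `Literature/NumberTheory/GaloisRepresentations`; a small *proofs* file (theorems only) for
the framed continuous representations `ρ : G →ₜ* GL_n(A)` of `ContinuousRep.lean`
(`Literature.NumberTheory.GaloisRepresentations.FramedRep`, `FramedRep.conj`,
`FramedRep.toContinuousRep`, `ContinuousRep.Equiv`) and the Galois-representation predicates of
`GaloisRep.lean` (`FramedGaloisRep.IsUnramifiedAt`, `FramedGaloisRep.HasFrobCharpolyAt`).

Uniqueness statements for Galois representations (`HarrisLanTaylorThorne2016.theoremA_uniqueness`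
of `Automorphic/ReciprocityGLnProofs`; the Chebotarev–Brauer–Nesbitt theorem
`FramedGaloisRep.nonempty_equiv_of_hasFrobCharpolyAt_eventually` of `LAdicRepFrobenius`; the
conclusion `ρ|_{Γ_{E_i}} ≃ ρ_i` of Sorensen's patching lemma in the proof of
Harris–Lan–Taylor–Thorne's Cor. 7.14) are isomorphisms of the underlying continuous
representations on `Aⁿ`, whereas the invariance lemmas of the tree (`isUnramifiedAt_conj_iff`,
`hasFrobCharpolyAt_conj_iff`, `isGaloisCompatibleAt_conj_iff`) are phrased for a change of frame
`ρ ↦ P ρ P⁻¹`.  This file bridges the two: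

* `FramedRep.exists_eq_conj_of_equiv` — an equivalence `e : ρ ≃ ρ'` of the continuous
  representations underlying two framed representations of the same rank exhibits `ρ'` as the
  conjugate `P ρ P⁻¹` by the matrix `P` of `e`;
* `FramedGaloisRep.isUnramifiedAt_of_equiv`, `FramedGaloisRep.hasFrobCharpolyAt_of_equiv` —
  hence unramifiedness at a place and the characteristic polynomial of Frobenius are invariants
  of the isomorphism class.

## References

* J.-P. Serre, *Abelian ℓ-adic representations and elliptic curves* (1968), Ch. I §1.1, §2.3
  (equivalent representations; `P_{v,ρ}` depends only on the isomorphism class).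
  [SerreAbelianLadic1968]
-/

noncomputable section

open scoped MatrixGroups Matrix NumberField

namespace Literature.NumberTheory.GaloisRepresentations

namespace FramedRep

universe u v

variable {G : Type u} {A : Type v} [Group G] [TopologicalSpace G] [CommRing A]
  [TopologicalSpace A] [IsTopologicalRing A] {n : ℕ}

/-- **Equivalent framed representations are conjugate.**  If the continuous representations on
`Aⁿ` underlying two framed representations `ρ, ρ' : G →ₜ* GL_n(A)` are equivalent
(`ContinuousRep.Equiv`: an equivariant linear homeomorphism `e`), then `ρ' = P ρ P⁻¹`
(`FramedRep.conj`) for the matrix `P ∈ GL_n(A)` of `e`.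
Serre 1968, Ch. I §1.1. [folklore] -/
theorem exists_eq_conj_of_equiv (ρ ρ' : FramedRep G A n)
    (e : ContinuousRep.Equiv ρ.toContinuousRep ρ'.toContinuousRep) :
    ∃ P : GL (Fin n) A, ρ' = ρ.conj P := by
  classical
  -- the matrices of `e` and `e⁻¹`
  set E : Matrix (Fin n) (Fin n) A := LinearMap.toMatrix' e.toLinearEquiv.toLinearMap with hE
  set E' : Matrix (Fin n) (Fin n) A := LinearMap.toMatrix' e.toLinearEquiv.symm.toLinearMap
    with hE'
  have hEE' : E * E' = 1 := by
    rw [hE, hE', ← LinearMap.toMatrix'_comp, ← LinearMap.toMatrix'_id]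
    congr 1
    exact LinearMap.ext fun v ↦ e.toLinearEquiv.apply_symm_apply v
  have hE'E : E' * E = 1 := by
    rw [hE, hE', ← LinearMap.toMatrix'_comp, ← LinearMap.toMatrix'_id]
    congr 1
    exact LinearMap.ext fun v ↦ e.toLinearEquiv.symm_apply_apply v
  let P : GL (Fin n) A := ⟨E, E', hEE', hE'E⟩
  refine ⟨P, ?_⟩
  -- equivariance in matrix form: `E ρ(g) = ρ'(g) E`
  have hcomm : ∀ g : G, E * ((ρ g : GL (Fin n) A) : Matrix (Fin n) (Fin n) A) =
      ((ρ' g : GL (Fin n) A) : Matrix (Fin n) (Fin n) A) * E := by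
    intro g
    apply Matrix.toLin'.injective
    refine LinearMap.ext fun v ↦ ?_
    rw [Matrix.toLin'_apply, Matrix.toLin'_apply, ← Matrix.mulVec_mulVec, ← Matrix.mulVec_mulVec,
      hE, LinearMap.toMatrix'_mulVec, LinearMap.toMatrix'_mulVec]
    exact e.apply_apply g v
  refine ContinuousMonoidHom.ext fun g ↦ Units.ext ?_
  rw [conj_apply, Units.val_mul, Units.val_mul]
  change ((ρ' g : GL (Fin n) A) : Matrix (Fin n) (Fin n) A) = E * (ρ g : GL (Fin n) A) * E'
  rw [hcomm, mul_assoc, hEE', mul_one]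

end FramedRep

/-! ## Invariants of the isomorphism class of a framed Galois representation -/

namespace FramedGaloisRep

open IsDedekindDomain

variable {K : Type*} [Field K] {A : Type*} [CommRing A] [TopologicalSpace A]
  [IsTopologicalRing A] {n : ℕ}

/-- **Unramifiedness is an invariant of the isomorphism class**: if the continuous
representations underlying `ρ, ρ'` are equivalent and `ρ` is unramified at `v`, so is `ρ'`
(`FramedRep.exists_eq_conj_of_equiv`, `isUnramifiedAt_conj_iff`). Serre 1968, Ch. I §2.1.
[folklore] -/
theorem isUnramifiedAt_of_equiv {ρ ρ' : FramedGaloisRep K A n}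
    (e : ContinuousRep.Equiv ρ.toGaloisRep ρ'.toGaloisRep) {v : HeightOneSpectrum (𝓞 K)}
    (h : ρ.IsUnramifiedAt v) : ρ'.IsUnramifiedAt v := by
  obtain ⟨P, rfl⟩ := FramedRep.exists_eq_conj_of_equiv ρ ρ' e
  exact (isUnramifiedAt_conj_iff v P ρ).mpr h

/-- **The characteristic polynomial of Frobenius is an invariant of the isomorphism class**: if
the continuous representations underlying `ρ, ρ'` are equivalent and every arithmetic Frobenius
at `v` has characteristic polynomial `Q` on `ρ`, the same holds on `ρ'` (conjugate matrices have
the same characteristic polynomial, Mathlib `Matrix.charpoly_units_conj`).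
Serre 1968, Ch. I §2.3. [folklore] -/
theorem hasFrobCharpolyAt_of_equiv {ρ ρ' : FramedGaloisRep K A n}
    (e : ContinuousRep.Equiv ρ.toGaloisRep ρ'.toGaloisRep) {v : HeightOneSpectrum (𝓞 K)}
    {Q : Polynomial A} (h : ρ.HasFrobCharpolyAt v Q) : ρ'.HasFrobCharpolyAt v Q := by
  obtain ⟨P, rfl⟩ := FramedRep.exists_eq_conj_of_equiv ρ ρ' e
  intro 𝔓 h𝔓 σ hσ
  rw [← h 𝔓 h𝔓 σ hσ]
  simp only [FramedRep.charpoly, FramedRep.conj_apply, Units.val_mul, Matrix.coe_units_inv]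
  exact Matrix.charpoly_units_conj P _

end FramedGaloisRep

end Literature.NumberTheory.GaloisRepresentations
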